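import Summits.BirchSwinnertonDyer.Rank1Residual.GaloisImage.KolyvaginSystemOfEulerSystemTorsionCoeff
import Summits.BirchSwinnertonDyer.Rank1Residual.GaloisImage.KatoKuriharaValueEmptyLevelSockets
import Summits.BirchSwinnertonDyer.Rank1Residual.GaloisImage.KolyvaginLevelOneUnitCaseOfKatoClasses
import Summits.BirchSwinnertonDyer.Rank1Residual.GaloisImage.PropagatedConditionTopOfNoTorsion
import Summits.BirchSwinnertonDyer.Rank1Residual.GaloisImage.KolyvaginPrimeFlagLevelOne
import Literature.NumberTheory.EllipticCurves.NonEisensteinPrimeOfSurjective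
import Literature.NumberTheory.EllipticCurves.TorsionFrobeniusProofs
import Literature.NumberTheory.EllipticCurves.ModularSymbolsHeckeProofs
import Summits.BirchSwinnertonDyer.Rank1Residual.GaloisImage.KolyvaginPrimeOfFrobeniusClass
import HarnessLib

/-!
# The EXOTIC unit case of `BSD(E, 3)` at level one FROM KATO'S EULER SYSTEM: the PORT predicate
# DICT3₁ of `bsdp_three_of_dictionaryOne` DISCHARGED to Kato's cited fact's matrix `ZetaBody`, the
# (P-EXP) rider `KatoExpStarFiniteLevelAt`, THEOREM D and the row's certificates
# (sub-target R1-68 / ROW T-PK6-M1-END; cell `b2b-bsdres`, team n1011, seat p13 GEN 13;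
# ROUTE-1 §48.4 socket, §53.4–53.6, lead R5-102 (a))

HONEST FRAMING (cell `b2b-bsdres`, run/shared/lean/b2b/bsd-rank1-residual/, verbatim in every
file): the goal of the cell is to DELETE the COMBINATION-SHAPED residual classes of the
Birch–Swinnerton-Dyer formula for ALL analytic-rank `≤ 1` elliptic curves over `ℚ` — "full BSD
formula for every rank `≤ 1` curve in class `C`" assembled STRICTLY from published theorems — so
that the rank-`≤ 1` remainder becomes exactly the CONSTRUCTION-SHAPED classes, which are TYPED
(missing-input `Prop`s), NOT attempted. This is not "finishing BSD". Team n1011: research route on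
the CONSTRUCTION-SHAPED class X4 / §I N11 (route-1 PORT).  THIS IS AN END THEOREM WITH DISPLAYED
HYPOTHESES: it closes NO row by itself; EXOTIC unit-case rows are REDUCED from the PORT predicate
`KatoKuriharaDictionaryThreeOneAt` (flag `K22-Thm3.13-PORT@3`, not in print at `3`) to (a) the matrix
`Kato2004.ZetaBody` of the CITED fact `Kato2004.exists_eulerSystem_expStar_values` (Kato, Astérisque
295, Ex. 13.3 / Thm. 9.7 / Thm. 6.6 (1)) on DISPLAYED witnesses `(ι κ Λ c d a A z x)` — never
obtained inside an END (§48.4 socket rule), (b) the CONSTRUCTION-SHAPED (P-EXP) rider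
`KatoExpStarFiniteLevelAt W 3 0 0 v₃ Λ Λfin` (ROUTE-1 §53.4: Bloch–Kato §3 + local duality + r1's
LEMMA SAT; never `_holds`), (c) `hNorm` (R-κ (b)) and the two `3`-adic-unit ROW CERTIFICATES of the
auxiliary datum `(c, d, a, A)`, (d) THEOREM D's displayed binders (`hScdAN`: `S` contains the primes of `2cdAN`, whence the
`τ`-class primes are usable primes of Kato's system (E2, proved here) — they are Kolyvagin primes of
level `1` by `KolyvaginPrime.isKolyvaginPrime_one_of_mem_frobeniusClassPrimes` (E1, its own file);
the local certificates `hbad` (no `3`-torsion over `ℚ_w` at bad `w ≠ 3`, F10) and `ht0` (no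
`3`-torsion over `ℚ₃`, i.e. `t = 0`, F11)), plus the named
facts `hS24`/`hS24₂` (Sakamoto 2024), `hGZK`, the Poitou–Tate family and `hEP` carried verbatim from
`bsdp_three_of_katoClasses_levelOne`.  Nothing is booked; no mark / label / count moves; 0 defs,
0 facts, 0 sorry.

## Why the four clauses the consumer needs are all available without PK-4

`bsdp_three_of_katoClasses_levelOne` (n1011-p13, p266233) consumes from the dictionary ONLY: Kato's
family `κ`, a Kolyvagin system `κ′` unitriangularly congruent to it (I4), the (Λ)-KERNEL clause of the
functional on `𝓕̄_can(v₃)`, and the VALUE AT THE EMPTY LEVEL `Λ(loc₃ κ_∅) = u · 3^t · δ̃_1` with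
`t = 0`, `δ̃_1 ≠ 0`.  Here: `κ = κ′ :=` THEOREM D's Kolyvagin system of Kato's Euler system `z = hbody`'s
classes (n1011-p11 D6 `Derivative.Rat.exists_isKolyvaginSystem_propagatedSelmerStructure_torsionCoeff`
at `k = 0`, coefficients `E[3]_{ℤ₃}`, every coefficient binder discharged; its `htop` from `ht0` by
F11 `propagatedSelmerStructureOne_eq_top_of_torsion_eq_zero`); (I4) with `κ′ = κ` is `0 ∈ closure`;
the kernel clause is the rider's (i-b); the value is n1011-p13's
`KatoValue.apply_localization_eq_unit_mul_kuriharaNumber_one_of_depleted` (PK-5 (ii) at `r = ∅` with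
`l = 0`, `ZetaBody` (C4)+(C5) at the trivial character, n1011-p02's PK-L
`DepletedLValue.depletedTwistedL_one_eq_ratCast_prod_mul`, `[0]⁺ = L(f,1)/Ω⁺_f`), fed THEOREM D's
class at `r = ∅` through the pin glue `KatoValue.comp_oneCocycleClass_eq_of_pin` (`D_∅ = 1`,
`Finset.noncommProd_empty`; the pin `red_{1} = (a ↦ a_1)` holds by `rfl` for D6's `tateModuleRed`);
`δ̃_1 = ratModP 3 [0]⁺_f ≠ 0` is the row's `hunit` (`kuriharaNumber_one`).  The entire continuation of
the `(3A)`-depleted `L`-series is supplied inside (`exists_differentiable_eq_twistedLSeries_holds`).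
NOT used, by design: `Addv W 3`, `3 ∤ c₃`, the Manin binder and the period transfer of
`bsdp_three_of_dictionaryOne` (they fed the PORT predicate's antecedent; D-53-3 moved the
normalisation into `hNorm`).  E1 (every prime of the canonical `τ`-class is a Kolyvagin prime of level `1`) is
`KolyvaginPrime.isKolyvaginPrime_one_of_mem_frobeniusClassPrimes` (its own file); E2 (the `τ`-class
primes are usable primes of Kato's system) is proved here from `hScdAN`.

SERVED SUB-POPULATION AND ROW DATA (r1 GEN 44 binder review R-4/R-5; census numerals, not kill
kinds): `ht0` ⟺ the `t`-numeral `t1` at the place `3` (`E(ℚ₃)[3] = 0`; rows with `3`-torsion over `ℚ₃`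
are NOT served — lifting THEOREM D's `htop` at `p` is located sub-item E3, Mazur–Rubin App. A,
unstaffed); `hbad` ⟺ `t1` at every bad `w ≠ 3` (it fails exactly at `3`-anomalous bad places — those
rows go to the twin END on n1011-p15's T-DER-D4BN F2 socket, `hbad ↦ hcomp + hP''`, T-PK6-M1-END-b);
`hE` ⟺ every prime `q ∣ A` is `3`-non-anomalous (`(q + 1 − a_q)/q` a `3`-unit; `A`'s prime support is
the filer's choice, always available by Chebotarev under surjectivity — display it in the record);
`hR0`/`hR` ⟺ the level-`A` minus-symbol combination `R⁻(c,d,a,A,d′)` is a non-zero `3`-adic unit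
(rows `R⁻`-degenerate at every tried `A` stay on the PORT-predicate END and are reported per label);
`hScdAN`, `h3S`, `hbadS` ⟺ the finite set `S` contains `∞`, `3`, the bad places and the primes of
`2cdAN`.

References: K. Kato, Astérisque 295 (2004) [Kato2004Asterisque]; C.-H. Kim, AJM 148 (2026)
[Kim2022StructureSelmer]; R. Sakamoto, JTNB 36 (2024) [Sakamoto2024]; B. Mazur, K. Rubin, Mem. AMS
799 (2004) [MazurRubin2004]; design `cells/n1011/ROUTE-1.md` §48.4, §53 (r1); skeleton
`cells/n1011/skel/T-PORT-1-PKIM.md` v0.3–v0.5 (p13).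
-/

noncomputable section

open scoped Classical NumberField ContRepresentation MatrixGroups TensorProduct
open CategoryTheory Field NumberField IsDedekindDomain CongruenceSubgroup
open WeierstrassCurve Literature.NumberTheory.EllipticCurves Literature.NumberTheory.EllipticCurves.ModularForms
  Literature.NumberTheory.GaloisRepresentations
  Literature.NumberTheory.GaloisRepresentations.DiscreteGaloisModule Literature.NumberTheory.GaloisCohomology
open Literature.NumberTheory.EllipticCurves.Rank1Residual
open Literature.NumberTheory.EllipticCurves.Kato2004
open Literature.NumberTheory.EllipticCurves.Kato2004.EulerSystemValues
open Literature.NumberTheory.DiophantineGeometry.Dioph (ratModP)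
open Summit.BirchSwinnertonDyer.Rank1Residual.GaloisImage.TorsionCoeff
open Rat.HeightOneSpectrum

namespace Summit.BirchSwinnertonDyer.Rank1Residual.GaloisImage

open KatoValue

variable (W : WeierstrassCurve ℚ) [W.IsElliptic] [W.IsGloballyMinimal]
  [ContinuousSMul ℤ_[3] (W.tateModule 3)] [Module.Free ℤ_[3] (W.tateModule 3)]
  [Module.Finite ℤ_[3] (W.tateModule 3)]

set_option backward.isDefEq.respectTransparency false in
/-- **THE EXOTIC UNIT CASE FROM KATO'S EULER SYSTEM — END-m1 with the PORT predicate DICT3₁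
DISCHARGED** (module docstring).  On a class-A1 row (`surj(3)`, `r_an = 0`, `3 ∤ #Ш_an`,
`E(ℚ₃)[3] = 0`, `[0]⁺_f` a `3`-adic unit) with Sakamoto's facts, `hGZK`, the Poitou–Tate / local
Euler–Poincaré data and the canonical `τ`-datum `D` exactly as in `bsdp_three_of_katoClasses_levelOne`,
the hypothesis `hDict : KatoKuriharaDictionaryThreeOneAt W 0 D v₃` of `bsdp_three_of_dictionaryOne` is
REPLACED by: Kato's witnesses `(ι κ Λ c d a A z x)` with `hbody : Kato2004.ZetaBody W 3 f …` and
`κ ≠ 0` (the matrix of the CITED fact `Kato2004.exists_eulerSystem_expStar_values`), the (P-EXP) rider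
`hfin : KatoExpStarFiniteLevelAt W 3 0 0 v₃ Λ Λfin` (ROUTE-1 §53.4), `hNorm` (§53.5), the auxiliary
guards and the two `3`-adic-unit certificates of `(c, d, a, A)` (`hE`, `hR0`/`hR`), and THEOREM D's
displayed binders (`hScdAN`, `hbad`, `ht0`) — then `BSD(E, 3)`.  Proof: THEOREM D for Kato's
system `z` at `k = 0` (n1011-p11 `exists_isKolyvaginSystem_propagatedSelmerStructure_torsionCoeff`,
fed `hbody.1`) ⇒ a Kolyvagin system `κ` for `𝓕_can` with `res κ_∅ = Φ_∅(red_* z_{0,∅})`; the VALUE at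
the empty level `Λfin(loc₃ κ_∅) = u · δ̃_1` (`KatoValue.…_of_depleted`, PK-5 (ii) + `ZetaBody` C4/C5 +
PK-L); `δ̃_1 = [0]⁺ mod 3 ≠ 0`; then `bsdp_three_of_katoClasses_levelOne` BY NAME (`κ′ = κ`, (I4)
trivial, (Λ)-kernel = the rider's clause (i-b)).  The `k = 0` spelling `E[3^0·3]` / `𝓕_can(0)` /
`ℤ/3^1` and the `E[3]` spelling agree definitionally (`propagatedSelmerStructure_three_zero`).
[cite: Kato2004Asterisque, Thm. 9.7 (p. 189), Thm. 6.6 (1) (p. 163), Ex. 13.3 (pp. 224–225)]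
[cite: Kim2022StructureSelmer, Thm. 3.13 and Thm. 1.9 (6)] [cite: Sakamoto2024, Thm. 4.4 (p. 926)]
[cite: MazurRubin2004, Thm. 3.2.4, App. A (Lemma A.1, Prop. A.2, (33))] -/
theorem bsdp_three_of_zetaBody_levelOne_unitCase
    (hS24 : Sakamoto2024.kolyvaginSystems_freeRankOne_zmod_three_pow)
    (hS24₂ : Sakamoto2024.kolyvaginSystems_idealOfBasis_eq_fittingIdeal_zmod_three_pow)
    (hGZK : rank_eq_analyticRank_of_analyticRank_le_one)
    [Finite (geomTorsion W ((3 : ℕ) : ℤ))]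
    (h3 : W.HasSurjectiveModNGaloisRep ((3 : ℕ) : ℤ)) (hr : W.analyticRank = 0)
    {q : ℚ} (hq : shaAn W = (q : ℂ)) (hv : padicValRat 3 q = 0)
    (τ : absoluteGaloisGroup ℚ) (hτμ : τ ∈ rootsOfUnityFixer ℚ 3)
    (hτq : Nonempty (cokerSubOne (W.torsionGaloisModule ((3 : ℕ) : ℤ)) τ ≃+ ZMod 3))
    (inv : LocalInvariants ℚ 3) (hperf : inv.IsPerfect) (hsum : inv.SumLocalTermEqZero)
    (hunro : inv.UnramifiedOrthogonal) (hcompl : inv.SelmerComplement)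
    (hEP : ∀ v : HeightOneSpectrum (𝓞 ℚ), localEulerPoincareCharacteristic (v.adicCompletion ℚ))
    (S : Finset (Place ℚ)) (hS : ∀ w : InfinitePlace ℚ, (Sum.inl w : Place ℚ) ∈ S)
    (h3S : ∀ v : HeightOneSpectrum (𝓞 ℚ), ((3 : ℕ) : 𝓞 ℚ) ∈ v.asIdeal → (Sum.inr v : Place ℚ) ∈ S)
    (hbadS : ∀ v : HeightOneSpectrum (𝓞 ℚ), ¬ W.HasGoodReductionAt v → (Sum.inr v : Place ℚ) ∈ S)
    (D : KolyvaginDatum (W.torsionGaloisModule ((3 : ℕ) : ℤ)))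
    (η : (q : HeightOneSpectrum (𝓞 ℚ)) → (ZMod (Ideal.absNorm q.asIdeal))ˣ)
    (hP : D.primes = frobeniusClassPrimes (W.torsionGaloisModule ((3 : ℕ) : ℤ))
      {v | (Sum.inr v : Place ℚ) ∈ S} τ 3)
    (hT : D.transverse = cyclotomicTransverse (W.torsionGaloisModule ((3 : ℕ) : ℤ)))
    (hD : D.HasCanonicalComparison 3 η)
    (v₃ : HeightOneSpectrum (𝓞 ℚ)) (hv₃ : ((3 : ℕ) : 𝓞 ℚ) ∈ v₃.asIdeal)
    -- Kato's fact's matrix, the rider and the row's data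
    {N : ℕ} [NeZero N] {f : CuspForm (Gamma0 N) 2} (hf : IsNewformOf W f)
    {ι : (m : ℕ) → (CyclotomicField m ℚ →+* ℂ)} {κ : ℝ}
    {Λ : ∀ (k : ℕ) (r : Finset (HeightOneSpectrum (𝓞 ℚ))),
      H1 (tateRep W 3) (cycSubgroup 3 k r) →ₗ[ℤ_[3]] ℚ_[3] ⊗[ℚ] CyclotomicField (cycLevel 3 k r) ℚ}
    {c d a : ℤ} {A : ℕ} [NeZero A]
    {z : ∀ (k : ℕ) (r : (cyclotomicLevelsRat 3 (badPlaces c d A N)).Ideals),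
      H1 (tateRep W 3) ((cyclotomicLevelsRat 3 (badPlaces c d A N)).level k r.1)}
    {x : ∀ (k : ℕ) (r : (cyclotomicLevelsRat 3 (badPlaces c d A N)).Ideals),
      CyclotomicField (cycLevel 3 k r.1) ℚ}
    (hκ0 : κ ≠ 0) (hbody : ZetaBody W 3 f ι κ Λ c d a A z x)
    (Λfin : galoisCohomology ((W.torsionGaloisModule ((3 : ℕ) : ℤ)).toLocal (Sum.inr v₃)) 1 →+ ZMod 3)
    (hfin : KatoExpStarFiniteLevelAt W 3 0 0 v₃ Λ Λfin)
    (hNorm : ∃ u : ℚ, (u : ℝ) = κ ∧ padicValRat 3 u = 0)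
    (d' : ℤ) (hcd : Int.gcd (c * d) A = 1) (hdd' : d * d' ≡ 1 [ZMOD (A : ℤ)])
    (hE : padicValRat 3 (∏ q ∈ (3 * A).primeFactors,
      (1 - (W.LFunction q : ℚ) / q + if q ∣ N then 0 else (1 : ℚ) / q)) = 0)
    (hR0 : ((c : ℚ) ^ 2 * (d : ℚ) ^ 2 * ratMinusSymbol f ((a : ℚ) / A)
        - (c : ℚ) * (d : ℚ) ^ 2 * ratMinusSymbol f ((a * c : ℚ) / A)
        - (c : ℚ) ^ 2 * (d : ℚ) * ratMinusSymbol f ((a * d' : ℚ) / A)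
        + (c : ℚ) * (d : ℚ) * ratMinusSymbol f ((a * c * d' : ℚ) / A)) ≠ 0)
    (hR : padicValRat 3 ((c : ℚ) ^ 2 * (d : ℚ) ^ 2 * ratMinusSymbol f ((a : ℚ) / A)
        - (c : ℚ) * (d : ℚ) ^ 2 * ratMinusSymbol f ((a * c : ℚ) / A)
        - (c : ℚ) ^ 2 * (d : ℚ) * ratMinusSymbol f ((a * d' : ℚ) / A)
        + (c : ℚ) * (d : ℚ) * ratMinusSymbol f ((a * c * d' : ℚ) / A)) = 0)
    (hunit : ratModP 3 (ratPlusSymbol f 0) ≠ 0)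
    -- THEOREM D's displayed binders (D6): usable primes, Kolyvagin primes, the two local certificates
    (hScdAN : ∀ v : HeightOneSpectrum (𝓞 ℚ),
      ((primesEquiv v : Nat.Primes) : ℕ) ∣ 2 * c.natAbs * d.natAbs * A * N → (Sum.inr v : Place ℚ) ∈ S)
    (hbad : ∀ w : HeightOneSpectrum (𝓞 ℚ), ¬ W.HasGoodReductionAt w →
      ((primesEquiv w : Nat.Primes) : ℕ) ≠ 3 →
        ∀ P : (W.baseChange (w.adicCompletion ℚ)).toAffine.Point, 3 • P = 0 → P = 0)
    (ht0 : ∀ w : HeightOneSpectrum (𝓞 ℚ), ((3 : ℕ) : 𝓞 ℚ) ∈ w.asIdeal →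
        ∀ P : (W.baseChange (w.adicCompletion ℚ)).toAffine.Point, 3 • P = 0 → P = 0) :
    BSDp W 3 := by
  letI := TorsionCoeff.torsionBy.padicIntModule 3 (0 + 1) (WeierstrassCurve.geomPoints W)
  -- an entire continuation of the `(3A)`-depleted series (Shimura; the tree's twisted continuation)
  obtain ⟨LA, hLA⟩ : ∃ LA : ℂ → ℂ,
      IsDepletedTwistedL f (cycLevel 3 0 ∅) (3 * A) (1 : DirichletCharacter ℂ (cycLevel 3 0 ∅)) LA :=
    exists_differentiable_eq_twistedLSeries_holds f _
  have hirr : W.HasIrreducibleModPGaloisRep 3 :=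
    hasIrreducibleModPGaloisRep_of_hasSurjectiveModNGaloisRep W 3 h3
  -- E2: the `τ`-class primes are usable primes of Kato's system (`S ⊇ prime(2cdAN)`, `3 ∉` them)
  have hPr : D.primes ⊆ (cyclotomicLevelsRat 3 (badPlaces c d A N)).primes := by
    intro v hvD
    rw [hP] at hvD
    obtain ⟨hvS, hv3, -⟩ := hvD
    refine (mem_primes_cyclotomicLevelsRat_badPlaces_iff 3 c d A N v).2 ⟨fun hdvd => hvS (hScdAN v hdvd), ?_⟩
    intro h3
    exact hv3 (KolyvaginPrime.natCast_mem_asIdeal_of_primesEquiv_eq h3)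
  -- E1: the `τ`-class primes are Kolyvagin primes of level `1` (`S ⊇` the bad places)
  have hKol : ∀ ℓ ∈ D.primes, Kato.IsKolyvaginPrime W 3 1 ((primesEquiv ℓ : Nat.Primes) : ℕ) := by
    intro ℓ hℓ
    rw [hP] at hℓ
    exact KolyvaginPrime.isKolyvaginPrime_one_of_mem_frobeniusClassPrimes W
      (fun v hv => Classical.not_not.mp fun hg => hv (hbadS v hg)) hτμ hτq hℓ
  -- `𝓕_can = ⊤` at the place(s) over `3` (t = 0: Mazur–Rubin Lemma A.1, F11)
  have htop : ∀ w : HeightOneSpectrum (𝓞 ℚ), ((primesEquiv w : Nat.Primes) : ℕ) = 3 →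
      propagatedSelmerStructure W 3 0 (Sum.inr w) = ⊤ := by
    intro w hw
    have hw3 : ((3 : ℕ) : 𝓞 ℚ) ∈ w.asIdeal := KolyvaginPrime.natCast_mem_asIdeal_of_primesEquiv_eq hw
    exact propagatedSelmerStructureOne_eq_top_of_torsion_eq_zero W 3 w hw3 (ht0 w hw3)
  -- THEOREM D (D6) for Kato's system `z` (`hbody.1`) at `k = 0`
  obtain ⟨σ, Φ, comm, κf, -, -, hΦ, hKS, -, hres⟩ :=
    Derivative.Rat.exists_isKolyvaginSystem_propagatedSelmerStructure_torsionCoeff W 3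
      (badPlaces c d A N) (by decide) hbody.1 0 hirr D hT hD hPr hKol hbad htop
  -- the admissible `Ψ := Φ_∅ ∘ red_*` (pin glue)
  let U : Subgroup (absoluteGaloisGroup ℚ) := cycSubgroup 3 0 ∅
  let redst := ContinuousCohomology.map (ContinuousMonoidHom.id U)
      (X := subgroupRep (tateRep W 3).toTopRep U)
      (Y := subgroupRep (torsionRepPadicInt W 3 (0 + 1)).toTopRep U)
      ((TopRep.resFunctor U.subtype).map (tateModuleRed W 3 (W.continuous_galoisRepTate_holds 3) (0 + 1))) 1
  let Ψ : H1 (tateRep W 3) (cycSubgroup 3 0 ∅) →+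
      continuousCohomology 1 (subgroupRep
        (W.torsionGaloisModule (((3 : ℕ) : ℤ) ^ 0 * ((3 : ℕ) : ℤ))).toTopRep (cycSubgroup 3 0 ∅)) :=
    (Φ ∅).comp redst.hom.toLinearMap.toAddMonoidHom
  have hΨ : ∀ (φ : contOneCocycles (subgroupRep (tateRep W 3).toTopRep (cycSubgroup 3 0 ∅)))
      (ψ : contOneCocycles (subgroupRep
        (W.torsionGaloisModule (((3 : ℕ) : ℤ) ^ 0 * ((3 : ℕ) : ℤ))).toTopRep (cycSubgroup 3 0 ∅))),
      (∀ g, ((ψ.1 g : geomTorsion W (((3 : ℕ) : ℤ) ^ 0 * ((3 : ℕ) : ℤ))) : geomPoints W) =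
        TateModule.proj 3 (0 + 1) (φ.1 g)) →
      Ψ (oneCocycleClass _ φ) = oneCocycleClass _ ψ := fun φ ψ h =>
    comp_oneCocycleClass_eq_of_pin (tateModuleRed W 3 (W.continuous_galoisRepTate_holds 3) (0 + 1))
      (AddSubgroup.inclusion (geomTorsion_pow_succ_eq W 3 0).le : _ →+ _) (fun _ => rfl)
      (cycSubgroup 3 0 ∅) (Φ ∅) (hΦ ∅) φ ψ h
  -- the derivative-class identity at the empty level: `D_∅ = 1`
  have hres' : resSubgroup (W.torsionGaloisModule (((3 : ℕ) : ℤ) ^ 0 * ((3 : ℕ) : ℤ))).toTopRep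
      (cycSubgroup 3 0 ∅) 1 (κf ∅) = Ψ (z 0 (cyclotomicLevelsRat 3 (badPlaces c d A N)).idealOne) := by
    have h := hres ∅ (by simp)
    rw [Finset.noncommProd_empty, Module.End.one_apply] at h
    exact h
  -- clause (0) at `v₃`: trivial since `𝓕_can,3 = ⊤`
  have hloc : galoisCohomology.localization
      (W.torsionGaloisModule (((3 : ℕ) : ℤ) ^ 0 * ((3 : ℕ) : ℤ))) (Sum.inr v₃) 1 (κf ∅) ∈
        propagatedSelmerStructure W 3 0 (Sum.inr v₃) := by
    rw [htop v₃ (primesEquiv_eq_of_natCast_mem Nat.prime_three hv₃)]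
    exact AddSubgroup.mem_top _
  -- the VALUE at the empty level (FILE 1/2): `Λfin(loc κ_∅) = u · 3^0 · δ̃_1`
  obtain ⟨u, hval⟩ := apply_localization_eq_unit_mul_kuriharaNumber_one_of_depleted hbody hf
    (by decide) hirr hfin hNorm hκ0 d' hcd hdd' hLA hE hR0 hR Ψ hΨ (κf ∅) hres' hloc (fun _ => 1)
  -- the EXOTIC unit-case END of record, fed with the classes
  exact bsdp_three_of_katoClasses_levelOne W hS24 hS24₂ hGZK h3 hr hq hv τ hτμ hτq inv hperf hsum
    hunro hcompl hEP S hS h3S hbadS D η hP hT hD v₃ κf ⟨κf, hKS⟩ (fun d _ => by simp) Λfin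
    hfin.2.1 hval rfl (by rw [kuriharaNumber_one]; exact hunit)

end Summit.BirchSwinnertonDyer.Rank1Residual.GaloisImage

end
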